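import Literature.Probability.FitznerVanDerHofstad2017.SrwLawKernelCount
import HarnessLib

/-!
# Exact simple-random-walk return counts in general dimension: the binomial dimension recursion solved

Topic `Literature/Probability/RandomPlanarGeometry` (Hara–Slade–Sokal loop-erasure lane; the Green-function inputs of the
`(2̃,1)` row of HSS93 Table 2, needed SYMBOLICALLY in `d` for an `s³`-sharp floor `μ(ℤ^d) ≥ 2d − 1 − 1/(2d) − 3/(4d²) −
9/(4d³) − C/d⁴`, door D1 of the lane).  The tree's `SrwCount.G x j m` (FvdH17 reproduction, `SrwLawKernelCount`) counts the
`m`-step nearest-neighbour walks `0 → x` using the first `j` coordinate directions, by the BINOMIAL DIMENSION RECURSION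
`G x (j+1) m = Σ_{a+b=m} C(m,a)·walk1 a x_j·G x j b` (`SrwCount.G_succ`), and `srwLaw d m x = G x d m/(2d)^m`
(`SrwCount.srwLaw_eq_srwCount_div`).  At a coordinate where `x_j = 0` the recursion is a fixed linear map on the vector
`(G x j 0, …, G x j m)` with coefficients `C(m,2i)·C(2i,i)`; hence for the origin `u_m(j) := G 0 j m` is a polynomial in `j`
of degree `m/2` (`u₂ = 2j`, `u₄ = 12j² − 6j`, `u₆ = 120j³ − 180j² + 80j`, `u₈ = 1680j⁴ − 5040j³ + 5740j² − 2310j`, …),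
proved here by induction on `j` through `m = 16`.  This module contains:

* §1 the one-dimensional counts `walk1 a 0`, `1 ≤ a ≤ 16` (kernel evaluation);
* §2 the EXPANDED dimension step at a vanishing coordinate, `G x (j+1) m = G x j m + C(m,2)·2·G x j (m−2) + …`
  (`m ≤ 16`), and the cross-dimension congruence `G_congr_dim` (`G x j m` reads only the coordinates `< j`);
* §3 the origin polynomials `u_m(j)`, `m = 0, 2, …, 16`, and the walk counts `srwCount d m 0 = u_m(d)` as polynomial identities in any commutative
ring (the return probabilities `p_m(0) = u_m(d)/(2d)^m` follow by `srwLaw_eq_srwCount_div`; the cases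
  `m ≤ 6` agree with the tree's `srwLaw_two_zero`, `srwLaw_four_zero`, `SAWLoopErasureKestenRenewalThird.srwLaw_six_zero`,
  which are NOT restated).

In the variable `s = 1/(2d)`: `Σ_{m ≤ 16} p_m(0) = 1 + s + 3s² + 12s³ + 60s⁴ + 355s⁵ + 2380s⁶ + 17430s⁷ + 134190s⁸ + O(s⁹)`
(HSS93 (A.7)/(6.24) bookkeeping).  The off-origin classes `|x|₁ ≤ 3` are the companion module
`SAWLoopErasureSrwNeighbourCounts`.  Pure combinatorics, `d`-generic, no numerics of the record.

References: [HSS93] T. Hara, G. Slade, A. D. Sokal, J. Stat. Phys. 72 (1993) 479–517, arXiv:hep-lat/9302003, Appendix A.1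
pp. 27–30 (the 1/d expansion of C₀(0,x;1/2d)) and (6.24); F. Spitzer, Principles of Random Walk (1976) §1 P1.3; tree:
`SrwCount.G_succ`, `SrwCount.srwLaw_eq_srwCount_div`.
-/

namespace Literature.Probability.RandomPlanarGeometry.SAW.Zd.LoopErasure

open Finset
open Literature.Probability.FitznerVanDerHofstad2017
open Literature.Probability.FitznerVanDerHofstad2017.SrwCount (coordD walk1 walk1_zero G G_zero G_succ G_zero_steps srwCount)

namespace SrwDimRec

variable {d : ℕ} {R : Type*} [CommRing R]

/-! ### §1 One-dimensional walk counts `walk1 a 0`, `1 ≤ a ≤ 16` -/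
/-- `walk1 1 0 = 0` (odd length: no return). [cite: HaraSladeSokal1993, Appendix A.1 pp. 27–30 (1/d expansion of C₀(0,x;1/2d)); lane plumbing] -/
theorem walk1_one_zero : walk1 1 0 = 0 := by decide +kernel
/-- `walk1 2 0 = 2` = C(2,1). [cite: HaraSladeSokal1993, Appendix A.1 pp. 27–30 (1/d expansion of C₀(0,x;1/2d)); lane plumbing] -/
theorem walk1_two_zero : walk1 2 0 = 2 := by decide +kernel
/-- `walk1 3 0 = 0` (odd length: no return). [cite: HaraSladeSokal1993, Appendix A.1 pp. 27–30 (1/d expansion of C₀(0,x;1/2d)); lane plumbing] -/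
theorem walk1_three_zero : walk1 3 0 = 0 := by decide +kernel
/-- `walk1 4 0 = 6` = C(4,2). [cite: HaraSladeSokal1993, Appendix A.1 pp. 27–30 (1/d expansion of C₀(0,x;1/2d)); lane plumbing] -/
theorem walk1_four_zero : walk1 4 0 = 6 := by decide +kernel
/-- `walk1 5 0 = 0` (odd length: no return). [cite: HaraSladeSokal1993, Appendix A.1 pp. 27–30 (1/d expansion of C₀(0,x;1/2d)); lane plumbing] -/
theorem walk1_five_zero : walk1 5 0 = 0 := by decide +kernel
/-- `walk1 6 0 = 20` = C(6,3). [cite: HaraSladeSokal1993, Appendix A.1 pp. 27–30 (1/d expansion of C₀(0,x;1/2d)); lane plumbing] -/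
theorem walk1_six_zero : walk1 6 0 = 20 := by decide +kernel
/-- `walk1 7 0 = 0` (odd length: no return). [cite: HaraSladeSokal1993, Appendix A.1 pp. 27–30 (1/d expansion of C₀(0,x;1/2d)); lane plumbing] -/
theorem walk1_seven_zero : walk1 7 0 = 0 := by decide +kernel
/-- `walk1 8 0 = 70` = C(8,4). [cite: HaraSladeSokal1993, Appendix A.1 pp. 27–30 (1/d expansion of C₀(0,x;1/2d)); lane plumbing] -/
theorem walk1_eight_zero : walk1 8 0 = 70 := by decide +kernel
/-- `walk1 9 0 = 0` (odd length: no return). [cite: HaraSladeSokal1993, Appendix A.1 pp. 27–30 (1/d expansion of C₀(0,x;1/2d)); lane plumbing] -/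
theorem walk1_nine_zero : walk1 9 0 = 0 := by decide +kernel
/-- `walk1 10 0 = 252` = C(10,5). [cite: HaraSladeSokal1993, Appendix A.1 pp. 27–30 (1/d expansion of C₀(0,x;1/2d)); lane plumbing] -/
theorem walk1_ten_zero : walk1 10 0 = 252 := by decide +kernel
/-- `walk1 11 0 = 0` (odd length: no return). [cite: HaraSladeSokal1993, Appendix A.1 pp. 27–30 (1/d expansion of C₀(0,x;1/2d)); lane plumbing] -/
theorem walk1_eleven_zero : walk1 11 0 = 0 := by decide +kernel
/-- `walk1 12 0 = 924` = C(12,6). [cite: HaraSladeSokal1993, Appendix A.1 pp. 27–30 (1/d expansion of C₀(0,x;1/2d)); lane plumbing] -/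
theorem walk1_twelve_zero : walk1 12 0 = 924 := by decide +kernel
/-- `walk1 13 0 = 0` (odd length: no return). [cite: HaraSladeSokal1993, Appendix A.1 pp. 27–30 (1/d expansion of C₀(0,x;1/2d)); lane plumbing] -/
theorem walk1_thirteen_zero : walk1 13 0 = 0 := by decide +kernel
/-- `walk1 14 0 = 3432` = C(14,7). [cite: HaraSladeSokal1993, Appendix A.1 pp. 27–30 (1/d expansion of C₀(0,x;1/2d)); lane plumbing] -/
theorem walk1_fourteen_zero : walk1 14 0 = 3432 := by decide +kernel
/-- `walk1 15 0 = 0` (odd length: no return). [cite: HaraSladeSokal1993, Appendix A.1 pp. 27–30 (1/d expansion of C₀(0,x;1/2d)); lane plumbing] -/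
theorem walk1_fifteen_zero : walk1 15 0 = 0 := by decide +kernel
/-- `walk1 16 0 = 12870` = C(16,8). [cite: HaraSladeSokal1993, Appendix A.1 pp. 27–30 (1/d expansion of C₀(0,x;1/2d)); lane plumbing] -/
theorem walk1_sixteen_zero : walk1 16 0 = 12870 := by decide +kernel

/-! ### §2 The dimension step at a vanishing coordinate, expanded (`m ≤ 16`) -/
/-- `G x j m` reads only the coordinates `< j` of `x` — also across ambient dimensions. [cite: HaraSladeSokal1993, Appendix A.1 pp. 27–30 (1/d
expansion of C₀(0,x;1/2d)); lane plumbing] -/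
theorem G_congr_dim {d d' : ℕ} {x : Fin d → ℤ} {x' : Fin d' → ℤ} :
    ∀ (j : ℕ), (∀ i < j, coordD x i = coordD x' i) → ∀ m, G x j m = G x' j m
  | 0, _, m => by simp
  | j + 1, h, m => by
      rw [G_succ, G_succ, h j (Nat.lt_succ_self j)]
      exact sum_congr rfl fun ij _ => by rw [G_congr_dim j (fun i hi => h i (Nat.lt_succ_of_lt hi)) ij.2]

/-- The dimension step at a vanishing coordinate, `m = 0`: `G x (j+1) 0 = Σ_{a even} C(0,a)·C(a,a/2)·G x j (0−a)`. [cite: HaraSladeSokal1993,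
Appendix A.1 pp. 27–30 (1/d expansion of C₀(0,x;1/2d)); lane plumbing] -/
theorem G_succ_expand_zero {x : Fin d → ℤ} {j : ℕ} (hx : coordD x j = 0) :
    G x (j + 1) 0 = G x j 0 := by
  rw [G_succ, hx, Finset.Nat.sum_antidiagonal_eq_sum_range_succ_mk]
  norm_num [Finset.sum_range_succ, Nat.choose, walk1_one_zero, walk1_two_zero, walk1_three_zero, walk1_four_zero, walk1_five_zero, walk1_six_zero,
      walk1_seven_zero, walk1_eight_zero, walk1_nine_zero, walk1_ten_zero, walk1_eleven_zero, walk1_twelve_zero, walk1_thirteen_zero,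
      walk1_fourteen_zero, walk1_fifteen_zero, walk1_sixteen_zero]
/-- The dimension step at a vanishing coordinate, `m = 1`: `G x (j+1) 1 = Σ_{a even} C(1,a)·C(a,a/2)·G x j (1−a)`. [cite: HaraSladeSokal1993,
Appendix A.1 pp. 27–30 (1/d expansion of C₀(0,x;1/2d)); lane plumbing] -/
theorem G_succ_expand_one {x : Fin d → ℤ} {j : ℕ} (hx : coordD x j = 0) :
    G x (j + 1) 1 = G x j 1 := by
  rw [G_succ, hx, Finset.Nat.sum_antidiagonal_eq_sum_range_succ_mk]
  norm_num [Finset.sum_range_succ, Nat.choose, walk1_one_zero, walk1_two_zero, walk1_three_zero, walk1_four_zero, walk1_five_zero, walk1_six_zero,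
      walk1_seven_zero, walk1_eight_zero, walk1_nine_zero, walk1_ten_zero, walk1_eleven_zero, walk1_twelve_zero, walk1_thirteen_zero,
      walk1_fourteen_zero, walk1_fifteen_zero, walk1_sixteen_zero]
/-- The dimension step at a vanishing coordinate, `m = 2`: `G x (j+1) 2 = Σ_{a even} C(2,a)·C(a,a/2)·G x j (2−a)`. [cite: HaraSladeSokal1993,
Appendix A.1 pp. 27–30 (1/d expansion of C₀(0,x;1/2d)); lane plumbing] -/
theorem G_succ_expand_two {x : Fin d → ℤ} {j : ℕ} (hx : coordD x j = 0) :
    G x (j + 1) 2 = G x j 2 + 2 * G x j 0 := by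
  rw [G_succ, hx, Finset.Nat.sum_antidiagonal_eq_sum_range_succ_mk]
  norm_num [Finset.sum_range_succ, Nat.choose, walk1_one_zero, walk1_two_zero, walk1_three_zero, walk1_four_zero, walk1_five_zero, walk1_six_zero,
      walk1_seven_zero, walk1_eight_zero, walk1_nine_zero, walk1_ten_zero, walk1_eleven_zero, walk1_twelve_zero, walk1_thirteen_zero,
      walk1_fourteen_zero, walk1_fifteen_zero, walk1_sixteen_zero]
/-- The dimension step at a vanishing coordinate, `m = 3`: `G x (j+1) 3 = Σ_{a even} C(3,a)·C(a,a/2)·G x j (3−a)`. [cite: HaraSladeSokal1993,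
Appendix A.1 pp. 27–30 (1/d expansion of C₀(0,x;1/2d)); lane plumbing] -/
theorem G_succ_expand_three {x : Fin d → ℤ} {j : ℕ} (hx : coordD x j = 0) :
    G x (j + 1) 3 = G x j 3 + 6 * G x j 1 := by
  rw [G_succ, hx, Finset.Nat.sum_antidiagonal_eq_sum_range_succ_mk]
  norm_num [Finset.sum_range_succ, Nat.choose, walk1_one_zero, walk1_two_zero, walk1_three_zero, walk1_four_zero, walk1_five_zero, walk1_six_zero,
      walk1_seven_zero, walk1_eight_zero, walk1_nine_zero, walk1_ten_zero, walk1_eleven_zero, walk1_twelve_zero, walk1_thirteen_zero,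
      walk1_fourteen_zero, walk1_fifteen_zero, walk1_sixteen_zero]
  ring
/-- The dimension step at a vanishing coordinate, `m = 4`: `G x (j+1) 4 = Σ_{a even} C(4,a)·C(a,a/2)·G x j (4−a)`. [cite: HaraSladeSokal1993,
Appendix A.1 pp. 27–30 (1/d expansion of C₀(0,x;1/2d)); lane plumbing] -/
theorem G_succ_expand_four {x : Fin d → ℤ} {j : ℕ} (hx : coordD x j = 0) :
    G x (j + 1) 4 = G x j 4 + 12 * G x j 2 + 6 * G x j 0 := by
  rw [G_succ, hx, Finset.Nat.sum_antidiagonal_eq_sum_range_succ_mk]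
  norm_num [Finset.sum_range_succ, Nat.choose, walk1_one_zero, walk1_two_zero, walk1_three_zero, walk1_four_zero, walk1_five_zero, walk1_six_zero,
      walk1_seven_zero, walk1_eight_zero, walk1_nine_zero, walk1_ten_zero, walk1_eleven_zero, walk1_twelve_zero, walk1_thirteen_zero,
      walk1_fourteen_zero, walk1_fifteen_zero, walk1_sixteen_zero]
  ring
/-- The dimension step at a vanishing coordinate, `m = 5`: `G x (j+1) 5 = Σ_{a even} C(5,a)·C(a,a/2)·G x j (5−a)`. [cite: HaraSladeSokal1993,
Appendix A.1 pp. 27–30 (1/d expansion of C₀(0,x;1/2d)); lane plumbing] -/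
theorem G_succ_expand_five {x : Fin d → ℤ} {j : ℕ} (hx : coordD x j = 0) :
    G x (j + 1) 5 = G x j 5 + 20 * G x j 3 + 30 * G x j 1 := by
  rw [G_succ, hx, Finset.Nat.sum_antidiagonal_eq_sum_range_succ_mk]
  norm_num [Finset.sum_range_succ, Nat.choose, walk1_one_zero, walk1_two_zero, walk1_three_zero, walk1_four_zero, walk1_five_zero, walk1_six_zero,
      walk1_seven_zero, walk1_eight_zero, walk1_nine_zero, walk1_ten_zero, walk1_eleven_zero, walk1_twelve_zero, walk1_thirteen_zero,
      walk1_fourteen_zero, walk1_fifteen_zero, walk1_sixteen_zero]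
  ring
/-- The dimension step at a vanishing coordinate, `m = 6`: `G x (j+1) 6 = Σ_{a even} C(6,a)·C(a,a/2)·G x j (6−a)`. [cite: HaraSladeSokal1993,
Appendix A.1 pp. 27–30 (1/d expansion of C₀(0,x;1/2d)); lane plumbing] -/
theorem G_succ_expand_six {x : Fin d → ℤ} {j : ℕ} (hx : coordD x j = 0) :
    G x (j + 1) 6 = G x j 6 + 30 * G x j 4 + 90 * G x j 2 + 20 * G x j 0 := by
  rw [G_succ, hx, Finset.Nat.sum_antidiagonal_eq_sum_range_succ_mk]
  norm_num [Finset.sum_range_succ, Nat.choose, walk1_one_zero, walk1_two_zero, walk1_three_zero, walk1_four_zero, walk1_five_zero, walk1_six_zero,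
      walk1_seven_zero, walk1_eight_zero, walk1_nine_zero, walk1_ten_zero, walk1_eleven_zero, walk1_twelve_zero, walk1_thirteen_zero,
      walk1_fourteen_zero, walk1_fifteen_zero, walk1_sixteen_zero]
  ring
/-- The dimension step at a vanishing coordinate, `m = 7`: `G x (j+1) 7 = Σ_{a even} C(7,a)·C(a,a/2)·G x j (7−a)`. [cite: HaraSladeSokal1993,
Appendix A.1 pp. 27–30 (1/d expansion of C₀(0,x;1/2d)); lane plumbing] -/
theorem G_succ_expand_seven {x : Fin d → ℤ} {j : ℕ} (hx : coordD x j = 0) :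
    G x (j + 1) 7 = G x j 7 + 42 * G x j 5 + 210 * G x j 3 + 140 * G x j 1 := by
  rw [G_succ, hx, Finset.Nat.sum_antidiagonal_eq_sum_range_succ_mk]
  norm_num [Finset.sum_range_succ, Nat.choose, walk1_one_zero, walk1_two_zero, walk1_three_zero, walk1_four_zero, walk1_five_zero, walk1_six_zero,
      walk1_seven_zero, walk1_eight_zero, walk1_nine_zero, walk1_ten_zero, walk1_eleven_zero, walk1_twelve_zero, walk1_thirteen_zero,
      walk1_fourteen_zero, walk1_fifteen_zero, walk1_sixteen_zero]
  ring
/-- The dimension step at a vanishing coordinate, `m = 8`: `G x (j+1) 8 = Σ_{a even} C(8,a)·C(a,a/2)·G x j (8−a)`. [cite: HaraSladeSokal1993,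
Appendix A.1 pp. 27–30 (1/d expansion of C₀(0,x;1/2d)); lane plumbing] -/
theorem G_succ_expand_eight {x : Fin d → ℤ} {j : ℕ} (hx : coordD x j = 0) :
    G x (j + 1) 8 = G x j 8 + 56 * G x j 6 + 420 * G x j 4 + 560 * G x j 2 + 70 * G x j 0 := by
  rw [G_succ, hx, Finset.Nat.sum_antidiagonal_eq_sum_range_succ_mk]
  norm_num [Finset.sum_range_succ, Nat.choose, walk1_one_zero, walk1_two_zero, walk1_three_zero, walk1_four_zero, walk1_five_zero, walk1_six_zero,
      walk1_seven_zero, walk1_eight_zero, walk1_nine_zero, walk1_ten_zero, walk1_eleven_zero, walk1_twelve_zero, walk1_thirteen_zero,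
      walk1_fourteen_zero, walk1_fifteen_zero, walk1_sixteen_zero]
  ring
/-- The dimension step at a vanishing coordinate, `m = 9`: `G x (j+1) 9 = Σ_{a even} C(9,a)·C(a,a/2)·G x j (9−a)`. [cite: HaraSladeSokal1993,
Appendix A.1 pp. 27–30 (1/d expansion of C₀(0,x;1/2d)); lane plumbing] -/
theorem G_succ_expand_nine {x : Fin d → ℤ} {j : ℕ} (hx : coordD x j = 0) :
    G x (j + 1) 9 = G x j 9 + 72 * G x j 7 + 756 * G x j 5 + 1680 * G x j 3 + 630 * G x j 1 := by
  rw [G_succ, hx, Finset.Nat.sum_antidiagonal_eq_sum_range_succ_mk]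
  norm_num [Finset.sum_range_succ, Nat.choose, walk1_one_zero, walk1_two_zero, walk1_three_zero, walk1_four_zero, walk1_five_zero, walk1_six_zero,
      walk1_seven_zero, walk1_eight_zero, walk1_nine_zero, walk1_ten_zero, walk1_eleven_zero, walk1_twelve_zero, walk1_thirteen_zero,
      walk1_fourteen_zero, walk1_fifteen_zero, walk1_sixteen_zero]
  ring
/-- The dimension step at a vanishing coordinate, `m = 10`: `G x (j+1) 10 = Σ_{a even} C(10,a)·C(a,a/2)·G x j (10−a)`. [cite: HaraSladeSokal1993,
Appendix A.1 pp. 27–30 (1/d expansion of C₀(0,x;1/2d)); lane plumbing] -/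
theorem G_succ_expand_ten {x : Fin d → ℤ} {j : ℕ} (hx : coordD x j = 0) :
    G x (j + 1) 10 = G x j 10 + 90 * G x j 8 + 1260 * G x j 6 + 4200 * G x j 4 + 3150 * G x j 2 + 252 * G x j 0 := by
  rw [G_succ, hx, Finset.Nat.sum_antidiagonal_eq_sum_range_succ_mk]
  norm_num [Finset.sum_range_succ, Nat.choose, walk1_one_zero, walk1_two_zero, walk1_three_zero, walk1_four_zero, walk1_five_zero, walk1_six_zero,
      walk1_seven_zero, walk1_eight_zero, walk1_nine_zero, walk1_ten_zero, walk1_eleven_zero, walk1_twelve_zero, walk1_thirteen_zero,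
      walk1_fourteen_zero, walk1_fifteen_zero, walk1_sixteen_zero]
  ring
/-- The dimension step at a vanishing coordinate, `m = 11`: `G x (j+1) 11 = Σ_{a even} C(11,a)·C(a,a/2)·G x j (11−a)`. [cite: HaraSladeSokal1993,
Appendix A.1 pp. 27–30 (1/d expansion of C₀(0,x;1/2d)); lane plumbing] -/
theorem G_succ_expand_eleven {x : Fin d → ℤ} {j : ℕ} (hx : coordD x j = 0) :
    G x (j + 1) 11 = G x j 11 + 110 * G x j 9 + 1980 * G x j 7 + 9240 * G x j 5 + 11550 * G x j 3 + 2772 * G x j 1 := by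
  rw [G_succ, hx, Finset.Nat.sum_antidiagonal_eq_sum_range_succ_mk]
  norm_num [Finset.sum_range_succ, Nat.choose, walk1_one_zero, walk1_two_zero, walk1_three_zero, walk1_four_zero, walk1_five_zero, walk1_six_zero,
      walk1_seven_zero, walk1_eight_zero, walk1_nine_zero, walk1_ten_zero, walk1_eleven_zero, walk1_twelve_zero, walk1_thirteen_zero,
      walk1_fourteen_zero, walk1_fifteen_zero, walk1_sixteen_zero]
  ring
/-- The dimension step at a vanishing coordinate, `m = 12`: `G x (j+1) 12 = Σ_{a even} C(12,a)·C(a,a/2)·G x j (12−a)`. [cite: HaraSladeSokal1993,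
Appendix A.1 pp. 27–30 (1/d expansion of C₀(0,x;1/2d)); lane plumbing] -/
theorem G_succ_expand_twelve {x : Fin d → ℤ} {j : ℕ} (hx : coordD x j = 0) :
    G x (j + 1) 12 = G x j 12 + 132 * G x j 10 + 2970 * G x j 8 + 18480 * G x j 6 + 34650 * G x j 4 + 16632 * G x j 2 + 924 * G x j 0 := by
  rw [G_succ, hx, Finset.Nat.sum_antidiagonal_eq_sum_range_succ_mk]
  norm_num [Finset.sum_range_succ, Nat.choose, walk1_one_zero, walk1_two_zero, walk1_three_zero, walk1_four_zero, walk1_five_zero, walk1_six_zero,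
      walk1_seven_zero, walk1_eight_zero, walk1_nine_zero, walk1_ten_zero, walk1_eleven_zero, walk1_twelve_zero, walk1_thirteen_zero,
      walk1_fourteen_zero, walk1_fifteen_zero, walk1_sixteen_zero]
  ring
/-- The dimension step at a vanishing coordinate, `m = 13`: `G x (j+1) 13 = Σ_{a even} C(13,a)·C(a,a/2)·G x j (13−a)`. [cite: HaraSladeSokal1993,
Appendix A.1 pp. 27–30 (1/d expansion of C₀(0,x;1/2d)); lane plumbing] -/
theorem G_succ_expand_thirteen {x : Fin d → ℤ} {j : ℕ} (hx : coordD x j = 0) :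
    G x (j + 1) 13 = G x j 13 + 156 * G x j 11 + 4290 * G x j 9 + 34320 * G x j 7 + 90090 * G x j 5 + 72072 * G x j 3 + 12012 * G x j 1 := by
  rw [G_succ, hx, Finset.Nat.sum_antidiagonal_eq_sum_range_succ_mk]
  norm_num [Finset.sum_range_succ, Nat.choose, walk1_one_zero, walk1_two_zero, walk1_three_zero, walk1_four_zero, walk1_five_zero, walk1_six_zero,
      walk1_seven_zero, walk1_eight_zero, walk1_nine_zero, walk1_ten_zero, walk1_eleven_zero, walk1_twelve_zero, walk1_thirteen_zero,
      walk1_fourteen_zero, walk1_fifteen_zero, walk1_sixteen_zero]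
  ring
/-- The dimension step at a vanishing coordinate, `m = 14`: `G x (j+1) 14 = Σ_{a even} C(14,a)·C(a,a/2)·G x j (14−a)`. [cite: HaraSladeSokal1993,
Appendix A.1 pp. 27–30 (1/d expansion of C₀(0,x;1/2d)); lane plumbing] -/
theorem G_succ_expand_fourteen {x : Fin d → ℤ} {j : ℕ} (hx : coordD x j = 0) :
    G x (j + 1) 14 = G x j 14 + 182 * G x j 12 + 6006 * G x j 10 + 60060 * G x j 8 + 210210 * G x j 6 + 252252 * G x j 4 + 84084 * G x j 2 +
        3432 * G x j 0 := by
  rw [G_succ, hx, Finset.Nat.sum_antidiagonal_eq_sum_range_succ_mk]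
  norm_num [Finset.sum_range_succ, Nat.choose, walk1_one_zero, walk1_two_zero, walk1_three_zero, walk1_four_zero, walk1_five_zero, walk1_six_zero,
      walk1_seven_zero, walk1_eight_zero, walk1_nine_zero, walk1_ten_zero, walk1_eleven_zero, walk1_twelve_zero, walk1_thirteen_zero,
      walk1_fourteen_zero, walk1_fifteen_zero, walk1_sixteen_zero]
  ring
/-- The dimension step at a vanishing coordinate, `m = 15`: `G x (j+1) 15 = Σ_{a even} C(15,a)·C(a,a/2)·G x j (15−a)`. [cite: HaraSladeSokal1993,
Appendix A.1 pp. 27–30 (1/d expansion of C₀(0,x;1/2d)); lane plumbing] -/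
theorem G_succ_expand_fifteen {x : Fin d → ℤ} {j : ℕ} (hx : coordD x j = 0) :
    G x (j + 1) 15 = G x j 15 + 210 * G x j 13 + 8190 * G x j 11 + 100100 * G x j 9 + 450450 * G x j 7 + 756756 * G x j 5 + 420420 * G x j 3 +
        51480 * G x j 1 := by
  rw [G_succ, hx, Finset.Nat.sum_antidiagonal_eq_sum_range_succ_mk]
  norm_num [Finset.sum_range_succ, Nat.choose, walk1_one_zero, walk1_two_zero, walk1_three_zero, walk1_four_zero, walk1_five_zero, walk1_six_zero,
      walk1_seven_zero, walk1_eight_zero, walk1_nine_zero, walk1_ten_zero, walk1_eleven_zero, walk1_twelve_zero, walk1_thirteen_zero,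
      walk1_fourteen_zero, walk1_fifteen_zero, walk1_sixteen_zero]
  ring
/-- The dimension step at a vanishing coordinate, `m = 16`: `G x (j+1) 16 = Σ_{a even} C(16,a)·C(a,a/2)·G x j (16−a)`. [cite: HaraSladeSokal1993,
Appendix A.1 pp. 27–30 (1/d expansion of C₀(0,x;1/2d)); lane plumbing] -/
theorem G_succ_expand_sixteen {x : Fin d → ℤ} {j : ℕ} (hx : coordD x j = 0) :
    G x (j + 1) 16 = G x j 16 + 240 * G x j 14 + 10920 * G x j 12 + 160160 * G x j 10 + 900900 * G x j 8 + 2018016 * G x j 6 + 1681680 * G x j 4 +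
        411840 * G x j 2 + 12870 * G x j 0 := by
  rw [G_succ, hx, Finset.Nat.sum_antidiagonal_eq_sum_range_succ_mk]
  norm_num [Finset.sum_range_succ, Nat.choose, walk1_one_zero, walk1_two_zero, walk1_three_zero, walk1_four_zero, walk1_five_zero, walk1_six_zero,
      walk1_seven_zero, walk1_eight_zero, walk1_nine_zero, walk1_ten_zero, walk1_eleven_zero, walk1_twelve_zero, walk1_thirteen_zero,
      walk1_fourteen_zero, walk1_fifteen_zero, walk1_sixteen_zero]
  ring

/-! ### §3 The origin: `u_m(j) = G 0 j m` is a polynomial in `j` (`m ≤ 16`) -/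
/-- All coordinates of the origin vanish. [cite: HaraSladeSokal1993, Appendix A.1 pp. 27–30 (1/d expansion of C₀(0,x;1/2d)); lane plumbing] -/
theorem coordD_origin (j : ℕ) : coordD (0 : Fin d → ℤ) j = 0 := by
  unfold coordD; split_ifs <;> rfl

/-- `u_0(j) = G 0 j 0 = 1`. [cite: HaraSladeSokal1993, Appendix A.1 pp. 27–30 (1/d expansion of C₀(0,x;1/2d)); lane plumbing] -/
theorem G_origin_zero (j : ℕ) : ((G (0 : Fin d → ℤ) j 0 : ℕ) : R) = 1 := by
  rw [G_zero_steps, if_pos fun i _ => coordD_origin i, Nat.cast_one]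
/-- **`u_{2}(j) = G 0 j 2`** as a polynomial in `j`. [cite: HaraSladeSokal1993, Appendix A.1 pp. 27–30 (1/d expansion of the Green function
C₀(0,x;1/2d)); lane certificate] -/
theorem G_origin_two (j : ℕ) :
    ((G (0 : Fin d → ℤ) j 2 : ℕ) : R) = 2 * (j : R) := by
  induction j with
  | zero => simp
  | succ j ih =>
      rw [G_succ_expand_two (coordD_origin j)]
      push_cast
      rw [ih, G_origin_zero j]
      ring
/-- **`u_{4}(j) = G 0 j 4`** as a polynomial in `j`. [cite: HaraSladeSokal1993, Appendix A.1 pp. 27–30 (1/d expansion of the Green function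
C₀(0,x;1/2d)); lane certificate] -/
theorem G_origin_four (j : ℕ) :
    ((G (0 : Fin d → ℤ) j 4 : ℕ) : R) = 12 * (j : R) ^ 2 - 6 * (j : R) := by
  induction j with
  | zero => simp
  | succ j ih =>
      rw [G_succ_expand_four (coordD_origin j)]
      push_cast
      rw [ih, G_origin_two j, G_origin_zero j]
      ring
/-- **`u_{6}(j) = G 0 j 6`** as a polynomial in `j`. [cite: HaraSladeSokal1993, Appendix A.1 pp. 27–30 (1/d expansion of the Green function
C₀(0,x;1/2d)); lane certificate] -/
theorem G_origin_six (j : ℕ) :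
    ((G (0 : Fin d → ℤ) j 6 : ℕ) : R) = 120 * (j : R) ^ 3 - 180 * (j : R) ^ 2 + 80 * (j : R) := by
  induction j with
  | zero => simp
  | succ j ih =>
      rw [G_succ_expand_six (coordD_origin j)]
      push_cast
      rw [ih, G_origin_four j, G_origin_two j, G_origin_zero j]
      ring
/-- **`u_{8}(j) = G 0 j 8`** as a polynomial in `j`. [cite: HaraSladeSokal1993, Appendix A.1 pp. 27–30 (1/d expansion of the Green function
C₀(0,x;1/2d)); lane certificate] -/
theorem G_origin_eight (j : ℕ) :
    ((G (0 : Fin d → ℤ) j 8 : ℕ) : R) = 1680 * (j : R) ^ 4 - 5040 * (j : R) ^ 3 + 5740 * (j : R) ^ 2 - 2310 * (j : R) := by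
  induction j with
  | zero => simp
  | succ j ih =>
      rw [G_succ_expand_eight (coordD_origin j)]
      push_cast
      rw [ih, G_origin_six j, G_origin_four j, G_origin_two j, G_origin_zero j]
      ring
/-- **`u_{10}(j) = G 0 j 10`** as a polynomial in `j`. [cite: HaraSladeSokal1993, Appendix A.1 pp. 27–30 (1/d expansion of the Green function
C₀(0,x;1/2d)); lane certificate] -/
theorem G_origin_ten (j : ℕ) :
    ((G (0 : Fin d → ℤ) j 10 : ℕ) : R) = 30240 * (j : R) ^ 5 - 151200 * (j : R) ^ 4 + 315000 * (j : R) ^ 3 - 308700 * (j : R) ^ 2 +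
        114912 * (j : R) := by
  induction j with
  | zero => simp
  | succ j ih =>
      rw [G_succ_expand_ten (coordD_origin j)]
      push_cast
      rw [ih, G_origin_eight j, G_origin_six j, G_origin_four j, G_origin_two j, G_origin_zero j]
      ring
/-- **`u_{12}(j) = G 0 j 12`** as a polynomial in `j`. [cite: HaraSladeSokal1993, Appendix A.1 pp. 27–30 (1/d expansion of the Green function
C₀(0,x;1/2d)); lane certificate] -/
theorem G_origin_twelve (j : ℕ) :
    ((G (0 : Fin d → ℤ) j 12 : ℕ) : R) = 665280 * (j : R) ^ 6 - 4989600 * (j : R) ^ 5 + 16354800 * (j : R) ^ 4 - 28274400 * (j : R) ^ 3 +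
        24985884 * (j : R) ^ 2 - 8741040 * (j : R) := by
  induction j with
  | zero => simp
  | succ j ih =>
      rw [G_succ_expand_twelve (coordD_origin j)]
      push_cast
      rw [ih, G_origin_ten j, G_origin_eight j, G_origin_six j, G_origin_four j, G_origin_two j, G_origin_zero j]
      ring
/-- **`u_{14}(j) = G 0 j 14`** as a polynomial in `j`. [cite: HaraSladeSokal1993, Appendix A.1 pp. 27–30 (1/d expansion of the Green function
C₀(0,x;1/2d)); lane certificate] -/
theorem G_origin_fourteen (j : ℕ) :
    ((G (0 : Fin d → ℤ) j 14 : ℕ) : R) = 17297280 * (j : R) ^ 7 - 181621440 * (j : R) ^ 6 + 857656800 * (j : R) ^ 5 - 2270268000 * (j : R) ^ 4 +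
        3469810344 * (j : R) ^ 3 - 2835985152 * (j : R) ^ 2 + 943113600 * (j : R) := by
  induction j with
  | zero => simp
  | succ j ih =>
      rw [G_succ_expand_fourteen (coordD_origin j)]
      push_cast
      rw [ih, G_origin_twelve j, G_origin_ten j, G_origin_eight j, G_origin_six j, G_origin_four j, G_origin_two j, G_origin_zero j]
      ring
/-- **`u_{16}(j) = G 0 j 16`** as a polynomial in `j`. [cite: HaraSladeSokal1993, Appendix A.1 pp. 27–30 (1/d expansion of the Green function
C₀(0,x;1/2d)); lane certificate] -/
theorem G_origin_sixteen (j : ℕ) :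
    ((G (0 : Fin d → ℤ) j 16 : ℕ) : R) = 518918400 * (j : R) ^ 8 - 7264857600 * (j : R) ^ 7 + 46616169600 * (j : R) ^ 6 -
        174053880000 * (j : R) ^ 5 + 400894013520 * (j : R) ^ 4 - 559479800880 * (j : R) ^ 3 + 429754447980 * (j : R) ^ 2 - 136984998150 * (j : R) :=
        by
  induction j with
  | zero => simp
  | succ j ih =>
      rw [G_succ_expand_sixteen (coordD_origin j)]
      push_cast
      rw [ih, G_origin_fourteen j, G_origin_twelve j, G_origin_ten j, G_origin_eight j, G_origin_six j, G_origin_four j, G_origin_two j,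
          G_origin_zero j]
      ring

/-! ### §4 The walk counts `c_m(0; d) = srwCount d m 0 = u_m(d)` -/
/-- `c_0(0; d) = srwCount d 0 0 = 1`. [cite: HaraSladeSokal1993, Appendix A.1 pp. 27–30 (1/d expansion of C₀(0,x;1/2d)); lane plumbing] -/
theorem srwCount_origin_zero (d : ℕ) : ((srwCount d 0 (0 : Fin d → ℤ) : ℕ) : R) = 1 :=
  G_origin_zero d
/-- **`c_{2}(0; d) = srwCount d 2 0`**, the number of `2`-step closed walks on `ℤ^d`, as a polynomial in `d` (`p_{2}(0) = c_{2}(0;d)/(2d)^{2}` by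
`srwLaw_eq_srwCount_div`). [cite: HaraSladeSokal1993, Appendix A.1 pp. 27–30 (1/d expansion of the Green function C₀(0,x;1/2d)); lane certificate] -/
theorem srwCount_origin_two (d : ℕ) :
    ((srwCount d 2 (0 : Fin d → ℤ) : ℕ) : R) = 2 * (d : R) :=
  G_origin_two d
/-- **`c_{4}(0; d) = srwCount d 4 0`**, the number of `4`-step closed walks on `ℤ^d`, as a polynomial in `d` (`p_{4}(0) = c_{4}(0;d)/(2d)^{4}` by
`srwLaw_eq_srwCount_div`). [cite: HaraSladeSokal1993, Appendix A.1 pp. 27–30 (1/d expansion of the Green function C₀(0,x;1/2d)); lane certificate] -/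
theorem srwCount_origin_four (d : ℕ) :
    ((srwCount d 4 (0 : Fin d → ℤ) : ℕ) : R) = 12 * (d : R) ^ 2 - 6 * (d : R) :=
  G_origin_four d
/-- **`c_{6}(0; d) = srwCount d 6 0`**, the number of `6`-step closed walks on `ℤ^d`, as a polynomial in `d` (`p_{6}(0) = c_{6}(0;d)/(2d)^{6}` by
`srwLaw_eq_srwCount_div`). [cite: HaraSladeSokal1993, Appendix A.1 pp. 27–30 (1/d expansion of the Green function C₀(0,x;1/2d)); lane certificate] -/
theorem srwCount_origin_six (d : ℕ) :
    ((srwCount d 6 (0 : Fin d → ℤ) : ℕ) : R) = 120 * (d : R) ^ 3 - 180 * (d : R) ^ 2 + 80 * (d : R) :=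
  G_origin_six d
/-- **`c_{8}(0; d) = srwCount d 8 0`**, the number of `8`-step closed walks on `ℤ^d`, as a polynomial in `d` (`p_{8}(0) = c_{8}(0;d)/(2d)^{8}` by
`srwLaw_eq_srwCount_div`). [cite: HaraSladeSokal1993, Appendix A.1 pp. 27–30 (1/d expansion of the Green function C₀(0,x;1/2d)); lane certificate] -/
theorem srwCount_origin_eight (d : ℕ) :
    ((srwCount d 8 (0 : Fin d → ℤ) : ℕ) : R) = 1680 * (d : R) ^ 4 - 5040 * (d : R) ^ 3 + 5740 * (d : R) ^ 2 - 2310 * (d : R) :=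
  G_origin_eight d
/-- **`c_{10}(0; d) = srwCount d 10 0`**, the number of `10`-step closed walks on `ℤ^d`, as a polynomial in `d` (`p_{10}(0) = c_{10}(0;d)/(2d)^{10}`
by `srwLaw_eq_srwCount_div`). [cite: HaraSladeSokal1993, Appendix A.1 pp. 27–30 (1/d expansion of the Green function C₀(0,x;1/2d)); lane certificate]
-/
theorem srwCount_origin_ten (d : ℕ) :
    ((srwCount d 10 (0 : Fin d → ℤ) : ℕ) : R) = 30240 * (d : R) ^ 5 - 151200 * (d : R) ^ 4 + 315000 * (d : R) ^ 3 - 308700 * (d : R) ^ 2 +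
        114912 * (d : R) :=
  G_origin_ten d
/-- **`c_{12}(0; d) = srwCount d 12 0`**, the number of `12`-step closed walks on `ℤ^d`, as a polynomial in `d` (`p_{12}(0) = c_{12}(0;d)/(2d)^{12}`
by `srwLaw_eq_srwCount_div`). [cite: HaraSladeSokal1993, Appendix A.1 pp. 27–30 (1/d expansion of the Green function C₀(0,x;1/2d)); lane certificate]
-/
theorem srwCount_origin_twelve (d : ℕ) :
    ((srwCount d 12 (0 : Fin d → ℤ) : ℕ) : R) = 665280 * (d : R) ^ 6 - 4989600 * (d : R) ^ 5 + 16354800 * (d : R) ^ 4 - 28274400 * (d : R) ^ 3 +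
        24985884 * (d : R) ^ 2 - 8741040 * (d : R) :=
  G_origin_twelve d
/-- **`c_{14}(0; d) = srwCount d 14 0`**, the number of `14`-step closed walks on `ℤ^d`, as a polynomial in `d` (`p_{14}(0) = c_{14}(0;d)/(2d)^{14}`
by `srwLaw_eq_srwCount_div`). [cite: HaraSladeSokal1993, Appendix A.1 pp. 27–30 (1/d expansion of the Green function C₀(0,x;1/2d)); lane certificate]
-/
theorem srwCount_origin_fourteen (d : ℕ) :
    ((srwCount d 14 (0 : Fin d → ℤ) : ℕ) : R) = 17297280 * (d : R) ^ 7 - 181621440 * (d : R) ^ 6 + 857656800 * (d : R) ^ 5 -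
        2270268000 * (d : R) ^ 4 + 3469810344 * (d : R) ^ 3 - 2835985152 * (d : R) ^ 2 + 943113600 * (d : R) :=
  G_origin_fourteen d
/-- **`c_{16}(0; d) = srwCount d 16 0`**, the number of `16`-step closed walks on `ℤ^d`, as a polynomial in `d` (`p_{16}(0) = c_{16}(0;d)/(2d)^{16}`
by `srwLaw_eq_srwCount_div`). [cite: HaraSladeSokal1993, Appendix A.1 pp. 27–30 (1/d expansion of the Green function C₀(0,x;1/2d)); lane certificate]
-/
theorem srwCount_origin_sixteen (d : ℕ) :
    ((srwCount d 16 (0 : Fin d → ℤ) : ℕ) : R) = 518918400 * (d : R) ^ 8 - 7264857600 * (d : R) ^ 7 + 46616169600 * (d : R) ^ 6 -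
        174053880000 * (d : R) ^ 5 + 400894013520 * (d : R) ^ 4 - 559479800880 * (d : R) ^ 3 + 429754447980 * (d : R) ^ 2 - 136984998150 * (d : R) :=
  G_origin_sixteen d

end SrwDimRec

end Literature.Probability.RandomPlanarGeometry.SAW.Zd.LoopErasure
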